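import Summits.CriticalPhenomena.PercolationContinuityZ3.Theorems.PercNearOneGluingNoHeavyConstsClusterSquareApicesGap
import HarnessLib

/-!
# Outerplanar graph plus independent apices: the TWO-PAIR endgame for clash vertices at a rim-rooted cluster

builds on p205010 (kernel theorem, internal audit signed; external expert review pending)

PAPER-2 track "percolation constants", part (ii), seat `prim-consts-1`, gen 22 (lane index
`run/shared/lean/prim/consts/CONSTANTS.md`, row A19; memo `FROM-prim-consts-1-g22-CROSS-LINKAGE.md`).
Support file for the crux `NoHeavyLowerTail` (stmt-CriticalPhenomena-4575; `--supports`).  Theorems only; no definitions, no sorries.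

SETTING (the class (I)(R)(F)(L)(L2) of `…ConstsClusterSquareApices.lean`, abstract graphs `G₀`, `Hp S`, `C x` of
`…ConstsClusterSquareApicesGap.lean`): `K ∋ a` is `H`-connected from the RIM vertex `a`; a CLASH VERTEX `v ∉ K` is joined to `K`
and carries two RIM REPRESENTATIVES `p, q ∉ K` — `v` itself (twice) if `v` is a rim vertex, two rim neighbours of `v` if `v` is an
apex (`Consts.Apices.exists_reps`: the second vertices of two walks leaving `v`).  `Consts.Apices.clash_link`: `v` is linked to a
rim vertex of `K` by an `Hp K`-edge (rim `v`) or an `H`-edge (apex `v`).  THE TWO-PAIR ENDGAME `Consts.Apices.false_of_twoPair`: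
two distinct clash vertices `v, w` with representatives `p, q` and `p', q'`, the link of each not strictly between the
representatives of the other (cut open at `a`), can NOT be in the crossed order `p < p'`, `q' < q`.  Cases: a representative of one
strictly inside the chord of the other — its link edge interleaves that chord (`Consts.Apices.false_of_inside`, (F)/(L)); or the two
chords coincide, two apices with two common neighbours — a third common neighbour or interleaving chords to the `K`-links
(`Consts.Apices.false_of_tie`, (L2)/(L)).  Used by `…ConstsClusterSquareApicesQuadLinked.lean` (no cross-linkage of four clash
vertices) and `…ConstsClusterSquareApicesQuad.lean` (CSQ/DUU at rim roots for arbitrary terminals, TS for triples with a rim vertex).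
References: N. Gladkov, arXiv:2408.08457v2 (2024), Def. 4.2, Thm. 4.3; G. Chartrand, F. Harary, Ann. Inst. H. Poincaré B 3 (1967)
433–438 (outerplanar graphs).
-/

noncomputable section

open Classical

namespace Summit.CriticalPhenomena.PercolationContinuityZ3.Theorems

open MeasureTheory Finset Literature.Probability.LatticeModels Literature.Probability.Percolation

namespace Consts

namespace Apices

variable {n m : ℕ} {pos : Fin n → Fin m} {hub : Fin n → Prop}

/-! ### Order facts (all by `omega`) -/

/-- A value different from `X₁, X₂` and not strictly between them lies below `X₁` or above `X₂`. [folklore] -/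
private theorem arith_out {K X₁ X₂ : ℕ} (g : ¬ (X₁ < K ∧ K < X₂)) (d1 : K ≠ X₁) (d2 : K ≠ X₂) :
    K < X₁ ∨ X₂ < K := by
  omega

/-- The two-pair case split: with `P < P'` and `Q' < Q`, either an endpoint of one of the pairs `{P, Q}`, `{Q', P'}` lies strictly
inside the other, or the pairs coincide crosswise with `P < Q`. [folklore] -/
private theorem arith_tp {P Q P' Q' : ℕ} (h1 : P < P') (h2 : Q' < Q) :
    (P < P' ∧ P' < Q) ∨ (P < Q' ∧ Q' < Q) ∨ (Q' < P ∧ P < P') ∨ (Q' < Q ∧ Q < P') ∨ (Q' = P ∧ Q = P' ∧ P < Q) := by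
  omega

/-! ### Representatives of a clash vertex on its walks -/

/-- A hub with a walk-neighbourhood: for hubs pairwise non-adjacent, two walks from `v` to vertices `≠ v` carry RIM representatives
of `v` — `v` itself if `v` is a rim vertex, else the second vertices of the walks (rim neighbours of `v`). [folklore] -/
theorem exists_reps {H : SimpleGraph (Fin n)} (hI : ∀ u v, hub u → hub v → ¬ H.Adj u v) {v t t' : Fin n}
    (R : H.Walk v t) (R' : H.Walk v t') (hvt : v ≠ t) (hvt' : v ≠ t') :
    ∃ p q, ¬ hub p ∧ p ∈ R.support ∧ ¬ hub q ∧ q ∈ R'.support ∧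
      ((¬ hub v ∧ p = v ∧ q = v) ∨ (hub v ∧ H.Adj v p ∧ H.Adj v q)) := by
  by_cases hv : hub v
  · cases R with
    | nil => exact absurd rfl hvt
    | @cons _ p _ hp T =>
      cases R' with
      | nil => exact absurd rfl hvt'
      | @cons _ q _ hq T' =>
        exact ⟨p, q, fun h => hI v p hv h hp, by simp, fun h => hI v q hv h hq, by simp, Or.inr ⟨hv, hp, hq⟩⟩
  · exact ⟨v, v, hv, R.start_mem_support, hv, R'.start_mem_support, Or.inl ⟨hv, rfl, rfl⟩⟩

/-- In an `H`-connected `K` (walk form, from a rim vertex `a`) an apex `x ∈ K` has a RIM neighbour inside `K` (apices pairwise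
non-adjacent): the last step of a `K`-walk from `a` to `x`.  (Restated from `…ConstsClusterSquareApices.lean` to keep the import
chain of this file short.) [folklore] -/
private theorem exists_rim_nbr {H : SimpleGraph (Fin n)} (hI : ∀ u v, hub u → hub v → ¬ H.Adj u v)
    {K : Set (Fin n)} {a x : Fin n} (ha : ¬ hub a) (hx : hub x)
    (hW : ∃ W : H.Walk a x, ∀ v ∈ W.support, v ∈ K) : ∃ w, w ∈ K ∧ ¬ hub w ∧ H.Adj x w := by
  obtain ⟨W, hWK⟩ := hW
  cases hWr : W.reverse with
  | nil => exact absurd hx (by cases W with | nil => exact ha | cons h p => exact absurd hWr (by simp))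
  | cons hxw W' =>
    rename_i w
    refine ⟨w, hWK w ?_, fun hw => hI x w hx hw hxw, hxw⟩
    have : w ∈ W.reverse.support := by rw [hWr]; simp
    rwa [SimpleGraph.Walk.support_reverse, List.mem_reverse] at this

section Endgame

variable {H G₀ : SimpleGraph (Fin n)} {Hp : Set (Fin n) → SimpleGraph (Fin n)} {C : Fin n → SimpleGraph (Fin n)} {a : Fin n}
  (hpos : ∀ u v, ¬ hub u → ¬ hub v → pos u = pos v → u = v)
  (hI : ∀ u v, hub u → hub v → ¬ H.Adj u v)
  (g1 : ∀ u v, H.Adj u v → ¬ hub u → ¬ hub v → G₀.Adj u v)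
  (g2 : ∀ S u v, H.Adj u v → ¬ hub u → ¬ hub v → (Hp S).Adj u v)
  (g3 : ∀ (S : Set (Fin n)) x u v, hub x → x ∈ S → u ≠ v → ¬ hub u → ¬ hub v → H.Adj x u → H.Adj x v → (Hp S).Adj u v)
  (c1 : ∀ x u v, hub x → u ≠ v → ¬ hub u → ¬ hub v → H.Adj x u → H.Adj x v → (C x).Adj u v)
  (x0 : ∀ (S : Set (Fin n)) p q r s, (Hp S).Adj p q → G₀.Adj r s → (pos p - pos a).val < (pos r - pos a).val →
    (pos r - pos a).val < (pos q - pos a).val → (pos q - pos a).val < (pos s - pos a).val → False)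
  (x0' : ∀ (S : Set (Fin n)) p q r s, G₀.Adj p q → (Hp S).Adj r s → (pos p - pos a).val < (pos r - pos a).val →
    (pos r - pos a).val < (pos q - pos a).val → (pos q - pos a).val < (pos s - pos a).val → False)
  (xC : ∀ (S : Set (Fin n)) x p q r s, hub x → x ∉ S → (Hp S).Adj p q → (C x).Adj r s →
    (pos p - pos a).val < (pos r - pos a).val → (pos r - pos a).val < (pos q - pos a).val →
    (pos q - pos a).val < (pos s - pos a).val → False)
  (xC' : ∀ (S : Set (Fin n)) x p q r s, hub x → x ∉ S → (C x).Adj p q → (Hp S).Adj r s →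
    (pos p - pos a).val < (pos r - pos a).val → (pos r - pos a).val < (pos q - pos a).val →
    (pos q - pos a).val < (pos s - pos a).val → False)
  (xCC : ∀ x x' p q r s, hub x → hub x' → x ≠ x' → (C x).Adj p q → (C x').Adj r s →
    (pos p - pos a).val < (pos r - pos a).val → (pos r - pos a).val < (pos q - pos a).val →
    (pos q - pos a).val < (pos s - pos a).val → False)
  (ha : ¬ hub a)
include hpos hI g1 g2 g3 c1 x0 x0' xC xC' xCC ha

omit hpos g1 c1 x0 x0' xC xC' xCC in
/-- LINK OF A CLASH VERTEX: a vertex `v ∉ K` joined to the `H`-connected `K ∋ a` (walk form) is linked to a RIM vertex `k ∈ K` — by an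
`Hp K`-edge if `v` is a rim vertex (the `H`-edge itself, or the chord of an apex of `K`), by an `H`-edge if `v` is an apex (apices
are pairwise non-adjacent); the representative data is carried along. [folklore] -/
theorem clash_link {K : Set (Fin n)} (hKw : ∀ s ∈ K, ∃ W : H.Walk a s, ∀ v ∈ W.support, v ∈ K)
    {v p q kv : Fin n} (hvK : v ∉ K) (hkv : kv ∈ K) (hkvv : H.Adj kv v)
    (hv : (¬ hub v ∧ p = v ∧ q = v) ∨ (hub v ∧ H.Adj v p ∧ H.Adj v q)) :
    ∃ k, k ∈ K ∧ ¬ hub k ∧ ((p = v ∧ q = v ∧ (Hp K).Adj k v) ∨ (hub v ∧ H.Adj v k ∧ H.Adj v p ∧ H.Adj v q)) := by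
  rcases hv with ⟨hvh, hp, hq⟩ | ⟨hvh, hp, hq⟩
  · by_cases hkh : hub kv
    · obtain ⟨w, hwK, hw, hxw⟩ := exists_rim_nbr hI ha hkh (hKw kv hkv)
      exact ⟨w, hwK, hw, Or.inl ⟨hp, hq, g3 K kv w v hkh hkv (fun e => hvK (e ▸ hwK)) hw hvh hxw hkvv⟩⟩
    · exact ⟨kv, hkv, hkh, Or.inl ⟨hp, hq, g2 K kv v hkvv hkh hvh⟩⟩
  · exact ⟨kv, hkv, fun h => hI kv v h hvh hkvv, Or.inr ⟨hvh, hkvv.symm, hp, hq⟩⟩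

omit hpos hI g1 g2 g3 c1 x0 x0' ha in
/-- INSIDE A CHORD: for an apex `x ∉ K` with a chord `{p, q} ∈ C x` and a rim vertex `r` strictly between `p` and `q` (cut open at `a`)
that is joined to a rim vertex `k` outside `(p, q)` by an `Hp K`-edge or by a chord of another apex, the two interleave — impossible
by (F)/(L). [folklore] -/
theorem false_of_inside {K : Set (Fin n)} {x k r p q : Fin n} (hx : hub x) (hxK : x ∉ K) (hC : (C x).Adj p q)
    (hE : (Hp K).Adj k r ∨ ∃ x', hub x' ∧ x' ≠ x ∧ (C x').Adj k r)
    (l1 : (pos p - pos a).val < (pos r - pos a).val) (l2 : (pos r - pos a).val < (pos q - pos a).val)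
    (gk : ¬ ((pos p - pos a).val < (pos k - pos a).val ∧ (pos k - pos a).val < (pos q - pos a).val))
    (dkp : (pos k - pos a).val ≠ (pos p - pos a).val) (dkq : (pos k - pos a).val ≠ (pos q - pos a).val) : False := by
  rcases arith_out gk dkp dkq with hk | hk
  · rcases hE with hE | ⟨x', hx', hne, hE⟩
    · exact xC K x k r p q hx hxK hE hC hk l1 l2
    · exact xCC x' x k r p q hx' hx hne hE hC hk l1 l2
  · rcases hE with hE | ⟨x', hx', hne, hE⟩
    · exact xC' K x p q r k hx hxK hC hE.symm l1 l2 hk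
    · exact xCC x x' p q r k hx hx' hne.symm hC hE.symm l1 l2 hk

omit hI g1 g2 g3 x0 x0' xC xC' ha in
/-- THE (L2) TIE: two distinct apices `v, w` with two common rim neighbours `p ≠ q` outside `K` and rim `K`-neighbours `kv, kw ∈ K` that
are not strictly between `p` and `q` — then either `kv = kw` is a third common neighbour ((L2)), or two of the chords `{kv, p}`,
`{kv, q} ∈ C v`, `{kw, p}`, `{kw, q} ∈ C w` interleave ((L)). [folklore] -/
theorem false_of_tie (hL2 : ∀ x x' u v w, hub x → hub x' → x ≠ x' → u ≠ v → u ≠ w → v ≠ w →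
      H.Adj x u → H.Adj x v → H.Adj x w → H.Adj x' u → H.Adj x' v → H.Adj x' w → False)
    {K : Set (Fin n)} {v w p q kv kw : Fin n} (hv : hub v) (hw : hub w) (hvw : v ≠ w)
    (hp : ¬ hub p) (hq : ¬ hub q) (hpq : p ≠ q) (hpK : p ∉ K) (hqK : q ∉ K)
    (hkv : ¬ hub kv) (hkw : ¬ hub kw) (hkvK : kv ∈ K) (hkwK : kw ∈ K)
    (hvk : H.Adj v kv) (hvp : H.Adj v p) (hvq : H.Adj v q) (hwk : H.Adj w kw) (hwp : H.Adj w p) (hwq : H.Adj w q)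
    (gv : ¬ ((pos p - pos a).val < (pos kv - pos a).val ∧ (pos kv - pos a).val < (pos q - pos a).val) ∧
      ¬ ((pos q - pos a).val < (pos kv - pos a).val ∧ (pos kv - pos a).val < (pos p - pos a).val))
    (gw : ¬ ((pos p - pos a).val < (pos kw - pos a).val ∧ (pos kw - pos a).val < (pos q - pos a).val) ∧
      ¬ ((pos q - pos a).val < (pos kw - pos a).val ∧ (pos kw - pos a).val < (pos p - pos a).val)) : False := by
  have P : ∀ u v : Fin n, ¬ hub u → ¬ hub v → u ≠ v → (pos u - pos a).val ≠ (pos v - pos a).val :=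
    fun u v hu hv huv e => huv (hpos u v hu hv (NonCrossing.rot_injective (pos a) e))
  by_cases hk : kv = kw
  · subst hk
    exact hL2 v w kv p q hv hw hvw (fun e => hpK (e ▸ hkvK)) (fun e => hqK (e ▸ hkvK)) hpq hvk hvp hvq hwk hwp hwq
  · have dk := P kv kw hkv hkw hk
    have d12 := P p q hp hq hpq
    have dk₁1 := P kv p hkv hp (fun e => hpK (e ▸ hkvK))
    have dk₁2 := P kv q hkv hq (fun e => hqK (e ▸ hkvK))
    have dk₂1 := P kw p hkw hp (fun e => hpK (e ▸ hkwK))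
    have dk₂2 := P kw q hkw hq (fun e => hqK (e ▸ hkwK))
    have C11 : (C v).Adj kv p := c1 v kv p hv (fun e => hpK (e ▸ hkvK)) hkv hp hvk hvp
    have C12 : (C v).Adj kv q := c1 v kv q hv (fun e => hqK (e ▸ hkvK)) hkv hq hvk hvq
    have C21 : (C w).Adj kw p := c1 w kw p hw (fun e => hpK (e ▸ hkwK)) hkw hp hwk hwp
    have C22 : (C w).Adj kw q := c1 w kw q hw (fun e => hqK (e ▸ hkwK)) hkw hq hwk hwq
    obtain ⟨gva, gvb⟩ := gv
    obtain ⟨gwa, gwb⟩ := gw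
    rcases Nat.lt_or_gt_of_ne d12 with h12p | h12p
    · have hk₁s := arith_out gva dk₁1 dk₁2
      have hk₂s := arith_out gwa dk₂1 dk₂2
      rcases hk₁s with l₁ | l₁ <;> rcases hk₂s with l₂ | l₂
      · rcases Nat.lt_or_gt_of_ne dk with l | l
        · exact xCC v w kv p kw q hv hw hvw C11 C22 l l₂ h12p
        · exact xCC w v kw p kv q hw hv hvw.symm C21 C12 l l₁ h12p
      · exact xCC v w kv q p kw hv hw hvw C12 C21.symm l₁ h12p l₂
      · exact xCC w v kw q p kv hw hv hvw.symm C22 C11.symm l₂ h12p l₁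
      · rcases Nat.lt_or_gt_of_ne dk with l | l
        · exact xCC v w p kv q kw hv hw hvw C11.symm C22.symm h12p l₁ l
        · exact xCC w v p kw q kv hw hv hvw.symm C21.symm C12.symm h12p l₂ l
    · have hk₁s := arith_out gvb dk₁2 dk₁1
      have hk₂s := arith_out gwb dk₂2 dk₂1
      rcases hk₁s with l₁ | l₁ <;> rcases hk₂s with l₂ | l₂
      · rcases Nat.lt_or_gt_of_ne dk with l | l
        · exact xCC v w kv q kw p hv hw hvw C12 C21 l l₂ h12p
        · exact xCC w v kw q kv p hw hv hvw.symm C22 C11 l l₁ h12p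
      · exact xCC v w kv p q kw hv hw hvw C11 C22.symm l₁ h12p l₂
      · exact xCC w v kw p q kv hw hv hvw.symm C21 C12.symm l₂ h12p l₁
      · rcases Nat.lt_or_gt_of_ne dk with l | l
        · exact xCC v w q kv p kw hv hw hvw C12.symm C21.symm h12p l₁ l
        · exact xCC w v q kw p kv hw hv hvw.symm C22.symm C11.symm h12p l₂ l

omit hI g1 g2 g3 x0 x0' ha in
/-- TWO-PAIR ENDGAME: two distinct clash vertices `v, w` with rim representatives `p, q` (of `v`) and `p', q'` (of `w`) outside `K`
(a rim clash vertex is its own representative and is joined to a rim vertex of `K` by an `Hp K`-edge; an apex clash vertex `∉ K`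
is adjacent to its representatives and to a rim vertex of `K`), the `K`-links not strictly between the representatives of the OTHER
vertex, and the CROSSED order `p < p'`, `q' < q` (cut open at `a`): impossible under (F)/(L)/(L2). [folklore: Jordan curve] -/
theorem false_of_twoPair (hL2 : ∀ x x' u v w, hub x → hub x' → x ≠ x' → u ≠ v → u ≠ w → v ≠ w →
      H.Adj x u → H.Adj x v → H.Adj x w → H.Adj x' u → H.Adj x' v → H.Adj x' w → False)
    {K : Set (Fin n)} {v w p q p' q' kv kw : Fin n} (hvw : v ≠ w) (hvK : v ∉ K) (hwK : w ∉ K)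
    (hp : ¬ hub p) (hq : ¬ hub q) (hp' : ¬ hub p') (hq' : ¬ hub q')
    (hpK : p ∉ K) (hqK : q ∉ K) (hp'K : p' ∉ K) (hq'K : q' ∉ K)
    (hkvK : kv ∈ K) (hkv : ¬ hub kv) (hkwK : kw ∈ K) (hkw : ¬ hub kw)
    (hv : (p = v ∧ q = v ∧ (Hp K).Adj kv v) ∨ (hub v ∧ H.Adj v kv ∧ H.Adj v p ∧ H.Adj v q))
    (hw : (p' = w ∧ q' = w ∧ (Hp K).Adj kw w) ∨ (hub w ∧ H.Adj w kw ∧ H.Adj w p' ∧ H.Adj w q'))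
    (gv : ¬ ((pos p' - pos a).val < (pos kv - pos a).val ∧ (pos kv - pos a).val < (pos q' - pos a).val) ∧
      ¬ ((pos q' - pos a).val < (pos kv - pos a).val ∧ (pos kv - pos a).val < (pos p' - pos a).val))
    (gw : ¬ ((pos p - pos a).val < (pos kw - pos a).val ∧ (pos kw - pos a).val < (pos q - pos a).val) ∧
      ¬ ((pos q - pos a).val < (pos kw - pos a).val ∧ (pos kw - pos a).val < (pos p - pos a).val))
    (h1 : (pos p - pos a).val < (pos p' - pos a).val) (h2 : (pos q' - pos a).val < (pos q - pos a).val) : False := by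
  have P : ∀ u v : Fin n, ¬ hub u → ¬ hub v → u ≠ v → (pos u - pos a).val ≠ (pos v - pos a).val :=
    fun u v hu hv huv e => huv (hpos u v hu hv (NonCrossing.rot_injective (pos a) e))
  have nK : ∀ {k u : Fin n}, k ∈ K → u ∉ K → k ≠ u := fun hk hu e => hu (e ▸ hk)
  have dvp' := P kv p' hkv hp' (nK hkvK hp'K)
  have dvq' := P kv q' hkv hq' (nK hkvK hq'K)
  have dwp := P kw p hkw hp (nK hkwK hpK)
  have dwq := P kw q hkw hq (nK hkwK hqK)
  -- the link edge of a representative: an `Hp K`-edge (rim clash vertex) or a chord of the clash apex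
  have Ev : ∀ r, (p = v ∧ q = v ∧ (Hp K).Adj kv v) → r = p ∨ r = q →
      ((Hp K).Adj kv r ∨ ∃ x', hub x' ∧ x' ≠ w ∧ (C x').Adj kv r) := by
    rintro r ⟨hpv, hqv, hE⟩ hr
    rcases hr with rfl | rfl
    · exact Or.inl (hpv ▸ hE)
    · exact Or.inl (hqv ▸ hE)
  have Ev' : ∀ r, (hub v ∧ H.Adj v kv ∧ H.Adj v p ∧ H.Adj v q) → ¬ hub r → r ∉ K → (r = p ∨ r = q) →
      ((Hp K).Adj kv r ∨ ∃ x', hub x' ∧ x' ≠ w ∧ (C x').Adj kv r) := by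
    rintro r ⟨hvh, hk, hvp, hvq⟩ hr hrK hr'
    refine Or.inr ⟨v, hvh, hvw, c1 v kv r hvh (nK hkvK hrK) hkv hr hk ?_⟩
    rcases hr' with rfl | rfl
    · exact hvp
    · exact hvq
  have Ew : ∀ r, (p' = w ∧ q' = w ∧ (Hp K).Adj kw w) → r = p' ∨ r = q' →
      ((Hp K).Adj kw r ∨ ∃ x', hub x' ∧ x' ≠ v ∧ (C x').Adj kw r) := by
    rintro r ⟨hpw, hqw, hE⟩ hr
    rcases hr with rfl | rfl
    · exact Or.inl (hpw ▸ hE)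
    · exact Or.inl (hqw ▸ hE)
  have Ew' : ∀ r, (hub w ∧ H.Adj w kw ∧ H.Adj w p' ∧ H.Adj w q') → ¬ hub r → r ∉ K → (r = p' ∨ r = q') →
      ((Hp K).Adj kw r ∨ ∃ x', hub x' ∧ x' ≠ v ∧ (C x').Adj kw r) := by
    rintro r ⟨hwh, hk, hwp, hwq⟩ hr hrK hr'
    refine Or.inr ⟨w, hwh, hvw.symm, c1 w kw r hwh (nK hkwK hrK) hkw hr hk ?_⟩
    rcases hr' with rfl | rfl
    · exact hwp
    · exact hwq
  have Er : ∀ r, ¬ hub r → r ∉ K → (r = p ∨ r = q) → ((Hp K).Adj kv r ∨ ∃ x', hub x' ∧ x' ≠ w ∧ (C x').Adj kv r) :=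
    fun r hr hrK hr' => hv.elim (fun h => Ev r h hr') (fun h => Ev' r h hr hrK hr')
  have Er' : ∀ r, ¬ hub r → r ∉ K → (r = p' ∨ r = q') → ((Hp K).Adj kw r ∨ ∃ x', hub x' ∧ x' ≠ v ∧ (C x').Adj kw r) :=
    fun r hr hrK hr' => hw.elim (fun h => Ew r h hr') (fun h => Ew' r h hr hrK hr')
  -- the chord of an apex clash vertex (only needed when its representatives are distinct in position)
  have Cv : (pos p - pos a).val ≠ (pos q - pos a).val → hub v ∧ v ∉ K ∧ (C v).Adj p q := by
    intro hne
    rcases hv with ⟨hpv, hqv, -⟩ | ⟨hvh, -, hvp, hvq⟩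
    · exact absurd (by rw [hpv, hqv]) hne
    · exact ⟨hvh, hvK, c1 v p q hvh (fun e => hne (by rw [e])) hp hq hvp hvq⟩
  have Cw : (pos q' - pos a).val ≠ (pos p' - pos a).val → hub w ∧ w ∉ K ∧ (C w).Adj q' p' := by
    intro hne
    rcases hw with ⟨hpw, hqw, -⟩ | ⟨hwh, -, hwp, hwq⟩
    · exact absurd (by rw [hpw, hqw]) hne
    · exact ⟨hwh, hwK, c1 w q' p' hwh (fun e => hne (by rw [e])) hq' hp' hwq hwp⟩
  rcases arith_tp h1 h2 with ⟨l1, l2⟩ | ⟨l1, l2⟩ | ⟨l1, l2⟩ | ⟨l1, l2⟩ | ⟨e1, e2, l⟩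
  · -- `p'` strictly inside the chord `{p, q}` of `v`
    obtain ⟨hvh, hvK', hC⟩ := Cv (by omega)
    exact false_of_inside xC xC' xCC hvh hvK' hC (Er' p' hp' hp'K (Or.inl rfl)) l1 l2 gw.1 dwp dwq
  · -- `q'` strictly inside the chord `{p, q}` of `v`
    obtain ⟨hvh, hvK', hC⟩ := Cv (by omega)
    exact false_of_inside xC xC' xCC hvh hvK' hC (Er' q' hq' hq'K (Or.inr rfl)) l1 l2 gw.1 dwp dwq
  · -- `p` strictly inside the chord `{q', p'}` of `w`
    obtain ⟨hwh, hwK', hC⟩ := Cw (by omega)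
    exact false_of_inside xC xC' xCC hwh hwK' hC (Er p hp hpK (Or.inl rfl)) l1 l2 gv.2 dvq' dvp'
  · -- `q` strictly inside the chord `{q', p'}` of `w`
    obtain ⟨hwh, hwK', hC⟩ := Cw (by omega)
    exact false_of_inside xC xC' xCC hwh hwK' hC (Er q hq hqK (Or.inr rfl)) l1 l2 gv.2 dvq' dvp'
  · -- the tie `q' = p`, `p' = q`: two apices with the two common neighbours `p ≠ q`
    have epq' : q' = p := hpos q' p hq' hp (NonCrossing.rot_injective (pos a) e1)
    have eqp' : q = p' := hpos q p' hq hp' (NonCrossing.rot_injective (pos a) e2)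
    have hpq : p ≠ q := fun e => by rw [e] at l; omega
    obtain ⟨hvh, -, -⟩ := Cv (by omega)
    obtain ⟨hwh, -, -⟩ := Cw (by omega)
    rcases hv with ⟨hpv, hqv, -⟩ | ⟨-, hvk, hvp, hvq⟩
    · exact absurd (hpv.trans hqv.symm) hpq
    rcases hw with ⟨hpw, hqw, -⟩ | ⟨-, hwk, hwp, hwq⟩
    · exact absurd (hqw.trans hpw.symm) (by rw [epq', ← eqp']; exact hpq)
    rw [epq'] at hwq gv
    rw [← eqp'] at hwp gv
    exact false_of_tie hpos c1 xCC hL2 hvh hwh hvw hp hq hpq hpK hqK hkv hkw hkvK hkwK hvk hvp hvq hwk hwq hwp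
      ⟨gv.2, gv.1⟩ gw

end Endgame

end Apices

end Consts

end Summit.CriticalPhenomena.PercolationContinuityZ3.Theorems
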